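import Literature.AlgebraicGeometry.Frobenioids.UnitTrivialisationRigidity
import Literature.AlgebraicGeometry.Frobenioids.UnitTrivialisationFunctoriality
import Literature.AlgebraicGeometry.Frobenioids.PreFrobenioidDataOfFunctor
import HarnessLib

/-!
# Frobenioids I, Theorem 3.4 (iv): rigidity of the composites of the unit-trivialisation square
# (PROOFS — sub-nodes `FrdI:Thm3.4(iv)/L10 UntrSquare` + `L11 UntrRigidity`, the glue for THE Frobenioids)

Mochizuki, *The geometry of Frobenioids I: the general theory*, Kyushu J. Math. **62** (2008), Theorem
3.4 (iv) p. 63 ll. 20–21 ("Finally, if `D₁`, `D₂` are slim, then each of the composite functors of this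
diagram is rigid"), proof p. 66 ll. 39–41: "since `C₁^un-tr`, `C₂^un-tr` are of unit-trivial type, the
asserted rigidity follows formally from Proposition 1.13, (ii)" [cite: MochizukiFrdI2008, Thm. 3.4 (iv) p.63].

The composites of the square are `Ψ^istr ⋙ (C₂^istr → C₂^un-tr) ≅ (C₁^istr → C₁^un-tr) ⋙ Ψ^un-tr`; as `Ψ^istr` is
an equivalence, their rigidity is that of the projection `C^istr → C^un-tr` itself — PROVED over a Div-slim base
by seat abc-iut-L1-d6 (`UnitTrivialisationRigidity.lean`, `isRigidFunctor_toUntr` / `isRigidFunctor_comp_toUntr`,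
the Cor. 4.11 (i) route), and slim ⇒ Div-slim (`PreFrobenioidData.isDivSlim_of_isSlim`). This file is the glue
for THE Frobenioids `ofFunctor Φ_i F_i` plus the direct Prop. 1.13 (ii) route for `C^istr → F_Φ`:

* `isotropicObjects_ofFunctor` — the two renderings of `C^istr` (data level / functor level) coincide;
* `isRigidFunctor_istrι_comp` — `C^istr ↪ C → F_Φ` is rigid for `D` slim (Prop. 1.13 (ii) for the Frobenioid
  `C^istr`, Prop. 1.9 (v));
* `thm34iv_untr_of_unitEquiv` — **the typed `Thm34iv_untr` for THE Frobenioids**, from an equivalence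
  `Ψ^istr : C₁^istr ≌ C₂^istr` such that `Ψ^istr` and its quasi-inverse preserve `≈^{O^×}`, and NOTHING ELSE
  (square/equivalence/`1`-uniqueness by d6's `thm34iv_untr_of_units`, rigidity by d6's
  `isRigidFunctor_comp_toUntr` over the Div-slim base supplied by `IsSlim D₂`).
-/

namespace Literature.AlgebraicGeometry.Frobenioids

namespace PreFrobenioid

open CategoryTheory Opposite

open PreFrobenioidData (ofFunctor)

universe w v v' u u'

section One

variable {D : Type u} [Category.{v} D] {Φ : Dᵒᵖ ⥤ CommMonCat.{w}} {C : Type u'} [Category.{v'} C]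
  {F : C ⥤ ElemFrobenioid Φ}

/-- The data-level and the functor-level classes of isotropic objects coincide (so the two renderings of
`C^istr` are the same full subcategory). [cite: MochizukiFrdI2008, Def. 1.2 (iv) p.23] -/
theorem isotropicObjects_ofFunctor : (ofFunctor Φ F).isotropicObjects = isotropicObjects F :=
  funext fun A => propext (PreFrobenioidData.ofFunctor_isIsotropic F A)

/-- `C^istr ↪ C → F_Φ` is rigid when `D` is slim: it is the Frobenioid `C^istr → F_Φ` (Prop. 1.9 (v)), to which
Prop. 1.13 (ii) applies. [cite: MochizukiFrdI2008, Prop. 1.13 (ii) p.39] -/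
theorem isRigidFunctor_istrι_comp (hF : IsFrobenioid F) (hD : IsSlim D) :
    IsRigidFunctor ((ofFunctor Φ F).istrι ⋙ F) := by
  change IsRigidFunctor ((ofFunctor Φ F).isotropicObjects.ι ⋙ F)
  rw [isotropicObjects_ofFunctor]
  exact isRigidFunctor_functor (isFrobenioid_istr hF) hD

end One

section Two

variable {D₁ : Type u} [Category.{v} D₁] {Φ₁ : D₁ᵒᵖ ⥤ CommMonCat.{w}} {C₁ : Type u'} [Category.{v'} C₁]
  {F₁ : C₁ ⥤ ElemFrobenioid Φ₁} {D₂ : Type u} [Category.{v} D₂] {Φ₂ : D₂ᵒᵖ ⥤ CommMonCat.{w}} {C₂ : Type u'}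
  [Category.{v'} C₂] {F₂ : C₂ ⥤ ElemFrobenioid Φ₂}

/-- **Theorem 3.4 (iv), unit-trivialisation square with rigidity, for THE Frobenioids**, from unit
preservation alone: if `Ψ^istr : C₁^istr ≌ C₂^istr` and its quasi-inverse preserve unit-equivalence, the typed
`Thm34iv_untr (ofFunctor Φ₁ F₁) (ofFunctor Φ₂ F₂) Ψ Ψ^istr` holds — the square, equivalence and `1`-uniqueness
by `thm34iv_untr_of_units` (`UnitTrivialisationFunctoriality.lean`, seat abc-iut-L1-d6), the rigidity of the
composites by d6's `isRigidFunctor_comp_toUntr` (Div-slim base ⇐ slim base). [cite: MochizukiFrdI2008, Thm. 3.4 (iv) p.63] -/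
theorem thm34iv_untr_of_unitEquiv (hF₂ : IsFrobenioid F₂) (Ψ : C₁ ≌ C₂)
    (G : (ofFunctor Φ₁ F₁).Istr ≌ (ofFunctor Φ₂ F₂).Istr)
    (hG : ∀ ⦃A B : (ofFunctor Φ₁ F₁).Istr⦄ (α₁ α₂ : A ⟶ B), (ofFunctor Φ₁ F₁).UnitEquiv α₁ α₂ →
      (ofFunctor Φ₂ F₂).UnitEquiv (G.functor.map α₁) (G.functor.map α₂))
    (hG' : ∀ ⦃A B : (ofFunctor Φ₂ F₂).Istr⦄ (β₁ β₂ : A ⟶ B), (ofFunctor Φ₂ F₂).UnitEquiv β₁ β₂ →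
      (ofFunctor Φ₁ F₁).UnitEquiv (G.inverse.map β₁) (G.inverse.map β₂)) :
    PreFrobenioidData.Thm34iv_untr (ofFunctor Φ₁ F₁) (ofFunctor Φ₂ F₂) Ψ G.functor :=
  PreFrobenioidData.thm34iv_untr_of_units _ _ Ψ G hG hG' fun _ hD₂ =>
    isRigidFunctor_comp_toUntr hF₂ ((ofFunctor Φ₂ F₂).isDivSlim_of_isSlim hD₂) G.functor

end Two

end PreFrobenioid

end Literature.AlgebraicGeometry.Frobenioids
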